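import Mathlib
import Summits.NavierStokesRegularity.NavierStokesRegularity.Theorems.EulerZoomLiouvillePowerGaugeEulerLiouvilleSelfSimilarFiniteNodalSet
import Literature.Analysis.FluidPDE.SelfSimilarEulerOutgoingFlatVorticity
import HarnessLib.Audit

/-!
# Rung C1 of the crux `EulerZoomLiouville.PowerGaugeEulerLiouville`: node certificates for SYMMETRIC
# linearisations, and the nodal-finiteness exclusion for profiles with NON-VORTICAL stagnation points

Route №10 `EulerZoomLiouville` (NavierStokesRegularity), crux E = stmt-NavierStokesRegularity-19832,
tenure rung C1, registered residue `stub_selfSimilarExtremal`.  Fifth file of the NODAL-FINITENESS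
chain (lineage ns-typeII-p2, gen 6): the linear algebra that certifies a node whose linearised
transport field is SYMMETRIC, and the resulting unconditional exclusion theorem.

* `symmetric_certificate_dichotomy` — **KILL ∨ THIN for symmetric operators.**  Let `M` be a
  symmetric operator on a finite-dimensional real inner product space with `tr M < β`.  Then either
  every eigenvalue is `< β`, and the inner product itself is a KILL certificate
  (`⟪Mv,v⟫ ≤ β'‖v‖²`, `β' < β`); or some eigenvalue is `≥ β`, hence (trace) the smallest eigenvalue
  `λ_min` is `< 0`, and `Q = Σ_{λ_i = λ_min} c_i² − Σ_{λ_i > λ_min} c_i²` (coordinates in an orthonormal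
  eigenbasis, Mathlib `LinearMap.IsSymmetric.eigenvectorBasis`) with `θ` in the spectral gap below
  `min(λ₂, 0)` is a THIN certificate.
* `certificate_of_curl_eq_zero` — at a NON-VORTICAL stagnation point `z` (`curl U(z) = 0`) of an
  in-window profile, `DV(z) = γI + DU(z)` is symmetric (tree `isSymmetric_fderiv_of_curl_eq_zero`,
  CIV: "in view of `Ω(y_*) = 0`, `∇U(y_*) = 𝕊_{y_*}`") with trace `3γ < 1 + γ` (`div U = 0`,
  `γ < ½`), so it is certified.
* `eq_zero_of_finite_nonvortical_nodalSet` — **COROLLARY A (unconditional): a `C²` self-similar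
  Euler profile with `0 < γ < ½` and the far field (3.8) whose nodal set is FINITE and consists of
  NON-VORTICAL points (`curl U = 0` on `𝒩_V`) is trivial.**  CIV Thm 3.10 needs, beyond finiteness,
  the outgoing inequality at every node (which by their Thm 3.8 forces the nodes to be non-vortical
  when `γ < ½`) AND analyticity of `Ω` at the nodes; the lineage's `eq_zero_of_isLocallyOutgoing_of_lt_half`
  removed analyticity; the present corollary removes the outgoing inequality as well
  (`eq_zero_of_isLocallyOutgoing_of_lt_half'` re-derives that theorem from it).

Remaining case for the unconditional «finite `𝒩_V` ⇒ trivial»: VORTICAL nodes (`Ω(z) ≠ 0`, whence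
`DV(z)Ω(z) = (1+γ)Ω(z)` and the other two eigenvalues have real parts summing to `2γ − 1 < 0`): a THIN
certificate always exists there but its construction needs the `2 × 2` Cayley–Hamilton case analysis
(next file).

WHAT THIS IS NOT: not NS, not E, not rung C1 — classical profiles with CIV's far field.

## References

* P. Constantin, M. Ignatova, V. Vicol, arXiv:2602.17570 (2026), §3.5 Def 3.7, Thm 3.8, Prop 3.9,
  Thm 3.10. [ConstantinIgnatovaVicol2026Putative]
-/

noncomputable section

-- flat `Theorems/<Route><Decl>…` files of one crux share the namespace of the crux (tree convention)
set_option linter.dupNamespace false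

open Set Filter Topology Metric Function InnerProductSpace
open scoped RealInnerProductSpace NNReal

namespace Summit.NavierStokesRegularity.NavierStokesRegularity.Theorems.PowerGaugeEulerLiouville.NodalFiniteness

open Literature.Analysis Literature.Analysis.FluidPDE Literature.Analysis.ODE

/-! ### Linear algebra: the certificate dichotomy for symmetric operators -/

section Symmetric

variable {E : Type*} [NormedAddCommGroup E] [InnerProductSpace ℝ E] [FiniteDimensional ℝ E]

omit [FiniteDimensional ℝ E] in
/-- The rank-one forms `v, w ↦ ⟪u, v⟫⟪u, w⟫` summed with weights `σ i` over an orthonormal basis: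
the continuous bilinear form `Σ σ_i c_i(v) c_i(w)`. [folklore] -/
private theorem diagForm_apply (ι : Type*) [Fintype ι] (b : OrthonormalBasis ι ℝ E) (σ : ι → ℝ)
    (v w : E) :
    (∑ i, σ i • (innerSL ℝ (b i)).smulRight (innerSL ℝ (b i)) : E →L[ℝ] E →L[ℝ] ℝ) v w =
      ∑ i, σ i * (⟪b i, v⟫ * ⟪b i, w⟫) := by
  simp only [FunLike.coe_sum, Finset.sum_apply, FunLike.coe_smul,
    Pi.smul_apply, ContinuousLinearMap.smulRight_apply, innerSL_apply_apply, smul_eq_mul]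

/-- **KILL ∨ THIN for a symmetric operator with small trace.**  Let `M` be a symmetric operator on a
finite-dimensional real inner product space with `tr M < β`.  Then EITHER there are a coercive
continuous bilinear form `B` and `β' < β` with `B(Mv,v) + B(v,Mv) ≤ 2β'B(v,v)` (all eigenvalues
`< β`; `B` = the inner product), OR there are a continuous bilinear form `Q`, a vector `e` with
`Q(e,e) > 0`, and `η > 0`, `θ ≤ 0` with `Q(Mv,v) + Q(v,Mv) ≤ 2θQ(v,v) − η‖v‖²` (some eigenvalue
`≥ β`, so by the trace bound the least eigenvalue is negative; `Q` = bottom eigenspace coordinates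
squared minus the others, `θ` in the gap).  Spectral theorem: Mathlib
`LinearMap.IsSymmetric.eigenvectorBasis`. [folklore] -/
theorem symmetric_certificate_dichotomy {M : E →L[ℝ] E} (hM : (M : E →ₗ[ℝ] E).IsSymmetric)
    {β : ℝ} (htr : LinearMap.trace ℝ E (M : E →ₗ[ℝ] E) < β) :
    (∃ (B : E →L[ℝ] E →L[ℝ] ℝ) (cB β' : ℝ), 0 < cB ∧ β' < β ∧ (∀ v, cB * ‖v‖ ^ 2 ≤ B v v) ∧
        ∀ v, B (M v) v + B v (M v) ≤ 2 * β' * B v v) ∨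
    (∃ (Q : E →L[ℝ] E →L[ℝ] ℝ) (η θ : ℝ) (e : E), 0 < η ∧ θ ≤ 0 ∧ 0 < Q e e ∧
        ∀ v, Q (M v) v + Q v (M v) ≤ 2 * θ * Q v v - η * ‖v‖ ^ 2) := by
  classical
  set n := Module.finrank ℝ E with hn'
  have hn : Module.finrank ℝ E = n := rfl
  set b := hM.eigenvectorBasis hn with hb
  set ev : Fin n → ℝ := hM.eigenvalues hn with hev
  have hMb : ∀ i, M (b i) = ev i • b i := fun i => hM.apply_eigenvectorBasis hn i
  -- coordinates `c i v = ⟪b i, v⟫`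
  have hcoordM : ∀ v i, ⟪b i, M v⟫ = ev i * ⟪b i, v⟫ := by
    intro v i
    have hsym := hM (b i) v
    simp only [ContinuousLinearMap.coe_coe] at hsym
    rw [← hsym, hMb, real_inner_smul_left]
  have hnormsq : ∀ v : E, ‖v‖ ^ 2 = ∑ i, ⟪b i, v⟫ * ⟪b i, v⟫ := by
    intro v
    rw [← real_inner_self_eq_norm_sq, ← b.sum_inner_mul_inner v v]
    exact Finset.sum_congr rfl fun i _ => by rw [real_inner_comm]
  -- the weighted diagonal forms
  set D : (Fin n → ℝ) → (E →L[ℝ] E →L[ℝ] ℝ) := fun σ =>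
    ∑ i, σ i • (innerSL ℝ (b i)).smulRight (innerSL ℝ (b i)) with hD
  have hDapply : ∀ σ v w, D σ v w = ∑ i, σ i * (⟪b i, v⟫ * ⟪b i, w⟫) :=
    fun σ v w => diagForm_apply (Fin n) b σ v w
  have hDM : ∀ σ v, D σ (M v) v + D σ v (M v) = ∑ i, (2 * (σ i * ev i)) * (⟪b i, v⟫ * ⟪b i, v⟫) := by
    intro σ v
    rw [hDapply, hDapply, ← Finset.sum_add_distrib]
    refine Finset.sum_congr rfl fun i _ => ?_
    rw [hcoordM]; ring
  have htrace : LinearMap.trace ℝ E (M : E →ₗ[ℝ] E) = ∑ i, ev i := hM.trace_eq_sum_eigenvalues hn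
  by_cases hall : ∀ i, ev i < β
  · -- KILL: all eigenvalues `< β`
    left
    -- a uniform `β' < β` above all eigenvalues
    obtain ⟨β', hβ'β, hβ'⟩ : ∃ β' : ℝ, β' < β ∧ ∀ i, ev i ≤ β' := by
      rcases isEmpty_or_nonempty (Fin n) with hE | hE
      · exact ⟨β - 1, by linarith, fun i => (IsEmpty.false i).elim⟩
      · obtain ⟨i₀, -, hi₀⟩ := Finset.exists_max_image Finset.univ ev Finset.univ_nonempty
        exact ⟨ev i₀, hall i₀, fun i => hi₀ i (Finset.mem_univ i)⟩
    refine ⟨D fun _ => 1, 1, β', one_pos, hβ'β, fun v => ?_, fun v => ?_⟩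
    · rw [hDapply, hnormsq, one_mul]
      exact le_of_eq (Finset.sum_congr rfl fun i _ => by ring)
    · rw [hDM, hDapply, Finset.mul_sum]
      refine Finset.sum_le_sum fun i _ => ?_
      have hsq : 0 ≤ ⟪b i, v⟫ * ⟪b i, v⟫ := mul_self_nonneg _
      have := hβ' i
      nlinarith
  · -- THIN: some eigenvalue `≥ β`, so the least one is negative
    right
    push Not at hall
    obtain ⟨i₀, hi₀⟩ := hall
    have hne : (Finset.univ : Finset (Fin n)).Nonempty := ⟨i₀, Finset.mem_univ _⟩
    obtain ⟨i₁, -, hi₁⟩ := Finset.exists_min_image Finset.univ ev hne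
    set lmin := ev i₁ with hlmin
    have hmin : ∀ i, lmin ≤ ev i := fun i => hi₁ i (Finset.mem_univ i)
    -- `lmin < 0` from the trace bound
    have hlmin_neg : lmin < 0 := by
      by_contra hge
      push Not at hge
      have hsum : β ≤ ∑ i, ev i := by
        rw [← Finset.add_sum_erase Finset.univ ev (Finset.mem_univ i₀)]
        have : 0 ≤ ∑ i ∈ Finset.univ.erase i₀, ev i :=
          Finset.sum_nonneg fun i _ => hge.trans (hmin i)
        linarith
      rw [← htrace] at hsum
      linarith
    -- the second value `l₂ = min {ev i : ev i ≠ lmin} ∪ {0}`-type gap bound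
    set Ipos : Finset (Fin n) := Finset.univ.filter fun i => lmin < ev i with hIpos
    obtain ⟨l₂, hl₂pos, hl₂⟩ : ∃ l₂ : ℝ, lmin < l₂ ∧ l₂ ≤ 0 ∧ ∀ i ∈ Ipos, l₂ ≤ ev i := by
      rcases Ipos.eq_empty_or_nonempty with hemp | hne'
      · exact ⟨0, hlmin_neg, le_rfl, fun i hi => by rw [hemp] at hi; exact absurd hi (by simp)⟩
      · obtain ⟨j, hj, hjmin⟩ := Finset.exists_min_image Ipos ev hne'
        refine ⟨min (ev j) 0, lt_min (by simpa [hIpos] using hj) hlmin_neg, min_le_right _ _,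
          fun i hi => (min_le_left _ _).trans (hjmin i hi)⟩
    obtain ⟨hl₂0, hl₂I⟩ := hl₂
    -- certificate data
    set θ : ℝ := (lmin + l₂) / 2 with hθ
    have hθlt : lmin < θ := by rw [hθ]; linarith
    have hθlt' : θ < l₂ := by rw [hθ]; linarith
    have hθ0 : θ ≤ 0 := by rw [hθ]; linarith
    set η : ℝ := min (2 * (θ - lmin)) (2 * (l₂ - θ)) with hη
    have hηpos : 0 < η := lt_min (by linarith) (by linarith)
    set σ : Fin n → ℝ := fun i => if lmin < ev i then -1 else 1 with hσ
    refine ⟨D σ, η, θ, b i₁, hηpos, hθ0, ?_, fun v => ?_⟩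
    · -- `Q(e,e) = 1 > 0` for `e = b i₁`
      rw [hDapply]
      have horth : ∀ i, ⟪b i, b i₁⟫ = if i = i₁ then 1 else 0 := fun i => by
        rw [b.inner_eq_ite]
      simp only [horth, mul_ite, mul_one, mul_zero, Finset.sum_ite_eq', Finset.mem_univ, if_true]
      simp [hσ, hlmin]
    · -- the cone inequality, termwise
      rw [hDM, hDapply, hnormsq, Finset.mul_sum, Finset.mul_sum, ← Finset.sum_sub_distrib]
      refine Finset.sum_le_sum fun i _ => ?_
      have hsq : 0 ≤ ⟪b i, v⟫ * ⟪b i, v⟫ := mul_self_nonneg _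
      by_cases hi : lmin < ev i
      · -- `σ i = -1`, `ev i ≥ l₂`
        have hσi : σ i = -1 := by simp [hσ, hi]
        have hevi : l₂ ≤ ev i := hl₂I i (by simpa [hIpos] using hi)
        have hη2 : η ≤ 2 * (l₂ - θ) := min_le_right _ _
        rw [hσi]
        nlinarith
      · -- `σ i = 1`, `ev i = lmin`
        have hσi : σ i = 1 := by simp [hσ, hi]
        have hevi : ev i = lmin := le_antisymm (not_lt.1 hi) (hmin i)
        have hη1 : η ≤ 2 * (θ - lmin) := min_le_left _ _
        rw [hσi, hevi]
        nlinarith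

end Symmetric

/-! ### Non-vortical stagnation points are certified -/

variable {γ C : ℝ} {c : EuclideanSpace ℝ (Fin 3)}
  {U : EuclideanSpace ℝ (Fin 3) → EuclideanSpace ℝ (Fin 3)} {P : EuclideanSpace ℝ (Fin 3) → ℝ}

/-- **A non-vortical node of an in-window profile is certified.**  If `curl U(z) = 0` then
`DV(z) = γI + DU(z)` is symmetric with trace `3γ < 1 + γ` (`div U = 0`, `γ < ½`), so
`symmetric_certificate_dichotomy` applies with `β = 1 + γ`.
[cite: ConstantinIgnatovaVicol2026Putative, §3.5 proof of Prop 3.9 ("∇U(y_*) = 𝕊_{y_*}")] -/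
theorem certificate_of_curl_eq_zero (h : IsSelfSimilarEulerProfile γ c U P) (hγ2 : γ < 1 / 2)
    {z : EuclideanSpace ℝ (Fin 3)} (hΩz : curl U z = 0) :
    (∃ (B : EuclideanSpace ℝ (Fin 3) →L[ℝ] EuclideanSpace ℝ (Fin 3) →L[ℝ] ℝ) (cB β' : ℝ),
        0 < cB ∧ β' < 1 + γ ∧ (∀ v, cB * ‖v‖ ^ 2 ≤ B v v) ∧
        ∀ v, B (fderiv ℝ (selfSimilarTransport γ c U) z v) v +
          B v (fderiv ℝ (selfSimilarTransport γ c U) z v) ≤ 2 * β' * B v v) ∨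
      (∃ (Q : EuclideanSpace ℝ (Fin 3) →L[ℝ] EuclideanSpace ℝ (Fin 3) →L[ℝ] ℝ) (η θ : ℝ)
        (e : EuclideanSpace ℝ (Fin 3)), 0 < η ∧ θ ≤ 0 ∧ 0 < Q e e ∧
        ∀ v, Q (fderiv ℝ (selfSimilarTransport γ c U) z v) v +
          Q v (fderiv ℝ (selfSimilarTransport γ c U) z v) ≤ 2 * θ * Q v v - η * ‖v‖ ^ 2) := by
  have hUd := h.differentiable_velocity
  have hDV : fderiv ℝ (selfSimilarTransport γ c U) z =
      γ • ContinuousLinearMap.id ℝ _ + fderiv ℝ U z :=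
    (hasFDerivAt_selfSimilarTransport hUd z).fderiv
  -- symmetry of `DV(z)`
  have hS : ((fderiv ℝ U z : EuclideanSpace ℝ (Fin 3) →L[ℝ] EuclideanSpace ℝ (Fin 3)) :
      EuclideanSpace ℝ (Fin 3) →ₗ[ℝ] EuclideanSpace ℝ (Fin 3)).IsSymmetric :=
    isSymmetric_fderiv_of_curl_eq_zero (hUd z) hΩz
  have hM : ((fderiv ℝ (selfSimilarTransport γ c U) z :
      EuclideanSpace ℝ (Fin 3) →L[ℝ] EuclideanSpace ℝ (Fin 3)) :
      EuclideanSpace ℝ (Fin 3) →ₗ[ℝ] EuclideanSpace ℝ (Fin 3)).IsSymmetric := by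
    rw [hDV]
    intro x y
    have hSxy := hS x y
    simp only [ContinuousLinearMap.coe_coe] at hSxy
    simp only [ContinuousLinearMap.coe_coe, add_apply,
      FunLike.coe_smul, Pi.smul_apply, ContinuousLinearMap.id_apply,
      inner_add_left, inner_add_right, real_inner_smul_left, real_inner_smul_right]
    rw [hSxy]
  -- trace `= 3γ < 1 + γ`
  have htr : LinearMap.trace ℝ _ (fderiv ℝ (selfSimilarTransport γ c U) z :
      EuclideanSpace ℝ (Fin 3) →ₗ[ℝ] EuclideanSpace ℝ (Fin 3)) < 1 + γ := by
    have hdiv : LinearMap.trace ℝ _ (fderiv ℝ U z :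
        EuclideanSpace ℝ (Fin 3) →ₗ[ℝ] EuclideanSpace ℝ (Fin 3)) = 0 := h.divFree z
    rw [hDV, ContinuousLinearMap.toLinearMap_add, ContinuousLinearMap.toLinearMap_smul, map_add,
      map_smul, hdiv, ContinuousLinearMap.coe_id, LinearMap.trace_id, finrank_euclideanSpace,
      Fintype.card_fin]
    norm_num
    linarith
  exact symmetric_certificate_dichotomy hM htr

/-! ### Corollary A: finite, non-vortical nodal set -/

/-- **COROLLARY A — NODAL-FINITENESS EXCLUSION FOR NON-VORTICAL NODES (unconditional).**  Let
`0 < γ < ½` and let `(U, P)` be a `C²` self-similar Euler profile (CIV (3.3)) with the far-field bounds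
(3.8).  If the nodal set `𝒩_V` of `V = γ(y−c) + U` is FINITE and `curl U = 0` at every node, then
`U ≡ 0`.  (Every node is certified by `certificate_of_curl_eq_zero`; conclude with
`eq_zero_of_finite_nodalSet_of_certificates`.)  Compare CIV Thm 3.10: there the nodes are finitely
many AND locally outgoing (hence non-vortical by Thm 3.8 when `γ < ½`) AND `Ω` is analytic at them.
[cite: ConstantinIgnatovaVicol2026Putative, §3.5 Thm 3.10 (finite nodal set; outgoing inequality and analyticity removed)] -/
theorem eq_zero_of_finite_nonvortical_nodalSet (h : IsSelfSimilarEulerProfile γ c U P)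
    (hγ : 0 < γ) (hγ2 : γ < 1 / 2) (hfar : HasSelfSimilarFarFieldWith γ c C U)
    (hfin : (selfSimilarNodalSet γ c U).Finite)
    (hnodes : ∀ z ∈ selfSimilarNodalSet γ c U, curl U z = 0) : U = 0 :=
  eq_zero_of_finite_nodalSet_of_certificates h hγ hγ2 hfar hfin
    fun z hz => certificate_of_curl_eq_zero h hγ2 (hnodes z hz)

/-- **CIV Theorem 3.10 without analyticity, re-derived** (the lineage's
`IsSelfSimilarEulerProfile.eq_zero_of_isLocallyOutgoing_of_lt_half`, now a one-line corollary): under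
the local outgoing property of Definition 3.7 (finite nodal set + the outgoing inequality) with
`γ < ½`, every node is non-vortical by CIV Thm 3.8 (tree
`IsSelfSimilarEulerProfile.curl_eq_zero_of_isLocallyOutgoing`), so Corollary A applies.
[cite: ConstantinIgnatovaVicol2026Putative, §3.5 Thm 3.10] -/
theorem eq_zero_of_isLocallyOutgoing_of_lt_half' (h : IsSelfSimilarEulerProfile γ c U P)
    (hγ : 0 < γ) (hγ2 : γ < 1 / 2) (hfar : HasSelfSimilarFarFieldWith γ c C U) {κ ε : ℝ}
    (hout : IsLocallyOutgoing γ c U κ ε) : U = 0 :=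
  eq_zero_of_finite_nonvortical_nodalSet h hγ hγ2 hfar hout.nodalSet_finite
    fun z hz => h.curl_eq_zero_of_isLocallyOutgoing hout (by linarith [hout.nonneg]) hz

end Summit.NavierStokesRegularity.NavierStokesRegularity.Theorems.PowerGaugeEulerLiouville.NodalFiniteness
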